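import Mathlib
import Summits.Ventures.PercRepro2.Defs
import Summits.Ventures.PercRepro2.Independence
import Summits.Ventures.PercRepro2.Harris
import Summits.Ventures.PercRepro2.ZCTwoEdge

/-!
# Theorem F (MINE-A.md §70.7) — the four cells of the two edges at the root `a₁`
(blind cell PercRepro2, mine-a g24)

Bookkeeping for `ZCRootW.lean` (the root `a₁` of degree two with neighbours `a₃` and the non-mark `w`,
`f₁ = a₁a₃`, `f₂ = a₁w`; in `G − a₁`: `A = {a₃ ↔ o}`, `W = {a₃ ↔ w}`, `Γ = {w ↔ o}`, the cluster events
`YK = {{a₁} ∪ C(a₃) ∈ 𝓔}`, `YW = {{a₁} ∪ C(w) ∈ 𝓔}`, `YB = {{a₁} ∪ C(a₃) ∪ C(w) ∈ 𝓔}`): with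
`e = {f₁ open} ∪ ({f₂ open} ∩ W)`, `L = ({f₁ open} ∩ A) ∪ ({f₂ open} ∩ Γ)`, `γ = A ∪ (e ∩ L)`,
`U = ({f₁ open, f₂ closed} ∩ YK) ∪ ({f₁ closed, f₂ open} ∩ YW) ∪ ({f₁, f₂ open} ∩ YB)` and
`A, W, Γ, YK, YW, YB` ignoring `f₁`, `f₂`, the seven probabilities of (ZC) expand over the four states of
`(f₁, f₂)` (`prob_two_pin`) into probabilities of events of `G − a₁`: `rootw_prob_eL`, `rootw_prob_enL`,
`rootw_prob_UeL`, `rootw_prob_UenL`, `rootw_prob_U`, `rootw_prob_B`, `rootw_prob_D`.  One seat.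
-/

namespace Summit.Ventures.PercRepro2

section Cells

variable {E : Type*} [Fintype E] [DecidableEq E] {R : Type*} [CommRing R]
  (p : E → R) {f₁ f₂ : E} (hf : f₁ ≠ f₂) {A W Γ YK YW YB : Set (Config E)}
  (hA : ∀ (ω : Config E) (b₁ b₂ : Bool), Function.update (Function.update ω f₁ b₁) f₂ b₂ ∈ A ↔ ω ∈ A)
  (hW : ∀ (ω : Config E) (b₁ b₂ : Bool), Function.update (Function.update ω f₁ b₁) f₂ b₂ ∈ W ↔ ω ∈ W)
  (hΓ : ∀ (ω : Config E) (b₁ b₂ : Bool), Function.update (Function.update ω f₁ b₁) f₂ b₂ ∈ Γ ↔ ω ∈ Γ)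
  (hYK : ∀ (ω : Config E) (b₁ b₂ : Bool), Function.update (Function.update ω f₁ b₁) f₂ b₂ ∈ YK ↔ ω ∈ YK)
  (hYW : ∀ (ω : Config E) (b₁ b₂ : Bool), Function.update (Function.update ω f₁ b₁) f₂ b₂ ∈ YW ↔ ω ∈ YW)
  (hYB : ∀ (ω : Config E) (b₁ b₂ : Bool), Function.update (Function.update ω f₁ b₁) f₂ b₂ ∈ YB ↔ ω ∈ YB)



include hf hA hW hΓ in
/-- The cell expansion of `P(e ∩ L)`. -/
lemma rootw_prob_eL :
    prob p ((openEdge f₁ ∪ (openEdge f₂ ∩ W)) ∩ ((openEdge f₁ ∩ A) ∪ (openEdge f₂ ∩ Γ)))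
      = p f₁ * p f₂ * prob p (A ∪ Γ) + p f₁ * (1 - p f₂) * prob p A
        + (1 - p f₁) * p f₂ * prob p (W ∩ Γ) := by
  have hs1 := update2_fst hf
  rw [prob_two_pin p hf]
  have e11 : {ω | Function.update (Function.update ω f₁ true) f₂ true ∈
      ((openEdge f₁ ∪ (openEdge f₂ ∩ W)) ∩ ((openEdge f₁ ∩ A) ∪ (openEdge f₂ ∩ Γ)))} = A ∪ Γ := by
    ext ω; simp [hs1, hA, hW, hΓ]
  have e10 : {ω | Function.update (Function.update ω f₁ true) f₂ false ∈
      ((openEdge f₁ ∪ (openEdge f₂ ∩ W)) ∩ ((openEdge f₁ ∩ A) ∪ (openEdge f₂ ∩ Γ)))} = A := by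
    ext ω; simp [hs1, hA, hW, hΓ]
  have e01 : {ω | Function.update (Function.update ω f₁ false) f₂ true ∈
      ((openEdge f₁ ∪ (openEdge f₂ ∩ W)) ∩ ((openEdge f₁ ∩ A) ∪ (openEdge f₂ ∩ Γ)))} = W ∩ Γ := by
    ext ω; simp [hs1, hA, hW, hΓ]
  have e00 : {ω | Function.update (Function.update ω f₁ false) f₂ false ∈
      ((openEdge f₁ ∪ (openEdge f₂ ∩ W)) ∩ ((openEdge f₁ ∩ A) ∪ (openEdge f₂ ∩ Γ)))} = ∅ := by
    ext ω; simp [hs1, hA, hW, hΓ]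
  rw [e11, e10, e01, e00, prob_empty]; ring

include hf hA hW hΓ in
/-- The cell expansion of `P(e ∩ Lᶜ)`. -/
lemma rootw_prob_enL :
    prob p ((openEdge f₁ ∪ (openEdge f₂ ∩ W)) ∩ ((openEdge f₁ ∩ A) ∪ (openEdge f₂ ∩ Γ))ᶜ)
      = p f₁ * p f₂ * prob p (A ∪ Γ)ᶜ + p f₁ * (1 - p f₂) * prob p Aᶜ
        + (1 - p f₁) * p f₂ * prob p (W ∩ Γᶜ) := by
  have hs1 := update2_fst hf
  rw [prob_two_pin p hf]
  have e11 : {ω | Function.update (Function.update ω f₁ true) f₂ true ∈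
      ((openEdge f₁ ∪ (openEdge f₂ ∩ W)) ∩ ((openEdge f₁ ∩ A) ∪ (openEdge f₂ ∩ Γ))ᶜ)} = (A ∪ Γ)ᶜ := by
    ext ω; simp [hs1, hA, hW, hΓ]
  have e10 : {ω | Function.update (Function.update ω f₁ true) f₂ false ∈
      ((openEdge f₁ ∪ (openEdge f₂ ∩ W)) ∩ ((openEdge f₁ ∩ A) ∪ (openEdge f₂ ∩ Γ))ᶜ)} = Aᶜ := by
    ext ω; simp [hs1, hA, hW, hΓ]
  have e01 : {ω | Function.update (Function.update ω f₁ false) f₂ true ∈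
      ((openEdge f₁ ∪ (openEdge f₂ ∩ W)) ∩ ((openEdge f₁ ∩ A) ∪ (openEdge f₂ ∩ Γ))ᶜ)} = W ∩ Γᶜ := by
    ext ω; simp [hs1, hA, hW, hΓ]
  have e00 : {ω | Function.update (Function.update ω f₁ false) f₂ false ∈
      ((openEdge f₁ ∪ (openEdge f₂ ∩ W)) ∩ ((openEdge f₁ ∩ A) ∪ (openEdge f₂ ∩ Γ))ᶜ)} = ∅ := by
    ext ω; simp [hs1, hA, hW, hΓ]
  rw [e11, e10, e01, e00, prob_empty]; ring

include hf hA hW hΓ hYK hYW hYB in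
/-- The cell expansion of `P(U ∩ e ∩ L)`. -/
lemma rootw_prob_UeL :
    prob p (((openEdge f₁ ∩ closedEdge f₂ ∩ YK) ∪ (closedEdge f₁ ∩ openEdge f₂ ∩ YW) ∪ (openEdge f₁ ∩ openEdge f₂ ∩ YB)) ∩ ((openEdge f₁ ∪ (openEdge f₂ ∩ W)) ∩ ((openEdge f₁ ∩ A) ∪ (openEdge f₂ ∩ Γ))))
      = p f₁ * p f₂ * prob p (YB ∩ (A ∪ Γ)) + p f₁ * (1 - p f₂) * prob p (YK ∩ A)
        + (1 - p f₁) * p f₂ * prob p (YW ∩ (W ∩ Γ)) := by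
  have hs1 := update2_fst hf
  rw [prob_two_pin p hf]
  have e11 : {ω | Function.update (Function.update ω f₁ true) f₂ true ∈
      (((openEdge f₁ ∩ closedEdge f₂ ∩ YK) ∪ (closedEdge f₁ ∩ openEdge f₂ ∩ YW) ∪ (openEdge f₁ ∩ openEdge f₂ ∩ YB)) ∩ ((openEdge f₁ ∪ (openEdge f₂ ∩ W)) ∩ ((openEdge f₁ ∩ A) ∪ (openEdge f₂ ∩ Γ))))} = YB ∩ (A ∪ Γ) := by
    ext ω; simp [hs1, hA, hW, hΓ, hYB]; tauto
  have e10 : {ω | Function.update (Function.update ω f₁ true) f₂ false ∈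
      (((openEdge f₁ ∩ closedEdge f₂ ∩ YK) ∪ (closedEdge f₁ ∩ openEdge f₂ ∩ YW) ∪ (openEdge f₁ ∩ openEdge f₂ ∩ YB)) ∩ ((openEdge f₁ ∪ (openEdge f₂ ∩ W)) ∩ ((openEdge f₁ ∩ A) ∪ (openEdge f₂ ∩ Γ))))} = YK ∩ A := by
    ext ω; simp [hs1, hA, hW, hΓ, hYK]
  have e01 : {ω | Function.update (Function.update ω f₁ false) f₂ true ∈
      (((openEdge f₁ ∩ closedEdge f₂ ∩ YK) ∪ (closedEdge f₁ ∩ openEdge f₂ ∩ YW) ∪ (openEdge f₁ ∩ openEdge f₂ ∩ YB)) ∩ ((openEdge f₁ ∪ (openEdge f₂ ∩ W)) ∩ ((openEdge f₁ ∩ A) ∪ (openEdge f₂ ∩ Γ))))} = YW ∩ (W ∩ Γ) := by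
    ext ω; simp [hs1, hA, hW, hΓ, hYW]; tauto
  have e00 : {ω | Function.update (Function.update ω f₁ false) f₂ false ∈
      (((openEdge f₁ ∩ closedEdge f₂ ∩ YK) ∪ (closedEdge f₁ ∩ openEdge f₂ ∩ YW) ∪ (openEdge f₁ ∩ openEdge f₂ ∩ YB)) ∩ ((openEdge f₁ ∪ (openEdge f₂ ∩ W)) ∩ ((openEdge f₁ ∩ A) ∪ (openEdge f₂ ∩ Γ))))} = ∅ := by
    ext ω; simp [hs1, hA, hW, hΓ]
  rw [e11, e10, e01, e00, prob_empty]; ring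

include hf hA hW hΓ hYK hYW hYB in
/-- The cell expansion of `P(U ∩ e ∩ Lᶜ)`. -/
lemma rootw_prob_UenL :
    prob p (((openEdge f₁ ∩ closedEdge f₂ ∩ YK) ∪ (closedEdge f₁ ∩ openEdge f₂ ∩ YW) ∪ (openEdge f₁ ∩ openEdge f₂ ∩ YB)) ∩ ((openEdge f₁ ∪ (openEdge f₂ ∩ W)) ∩ ((openEdge f₁ ∩ A) ∪ (openEdge f₂ ∩ Γ))ᶜ))
      = p f₁ * p f₂ * prob p (YB ∩ (A ∪ Γ)ᶜ) + p f₁ * (1 - p f₂) * prob p (YK ∩ Aᶜ)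
        + (1 - p f₁) * p f₂ * prob p (YW ∩ (W ∩ Γᶜ)) := by
  have hs1 := update2_fst hf
  rw [prob_two_pin p hf]
  have e11 : {ω | Function.update (Function.update ω f₁ true) f₂ true ∈
      (((openEdge f₁ ∩ closedEdge f₂ ∩ YK) ∪ (closedEdge f₁ ∩ openEdge f₂ ∩ YW) ∪ (openEdge f₁ ∩ openEdge f₂ ∩ YB)) ∩ ((openEdge f₁ ∪ (openEdge f₂ ∩ W)) ∩ ((openEdge f₁ ∩ A) ∪ (openEdge f₂ ∩ Γ))ᶜ))} = YB ∩ (A ∪ Γ)ᶜ := by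
    ext ω; simp [hs1, hA, hW, hΓ, hYB]; tauto
  have e10 : {ω | Function.update (Function.update ω f₁ true) f₂ false ∈
      (((openEdge f₁ ∩ closedEdge f₂ ∩ YK) ∪ (closedEdge f₁ ∩ openEdge f₂ ∩ YW) ∪ (openEdge f₁ ∩ openEdge f₂ ∩ YB)) ∩ ((openEdge f₁ ∪ (openEdge f₂ ∩ W)) ∩ ((openEdge f₁ ∩ A) ∪ (openEdge f₂ ∩ Γ))ᶜ))} = YK ∩ Aᶜ := by
    ext ω; simp [hs1, hA, hW, hΓ, hYK]
  have e01 : {ω | Function.update (Function.update ω f₁ false) f₂ true ∈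
      (((openEdge f₁ ∩ closedEdge f₂ ∩ YK) ∪ (closedEdge f₁ ∩ openEdge f₂ ∩ YW) ∪ (openEdge f₁ ∩ openEdge f₂ ∩ YB)) ∩ ((openEdge f₁ ∪ (openEdge f₂ ∩ W)) ∩ ((openEdge f₁ ∩ A) ∪ (openEdge f₂ ∩ Γ))ᶜ))} = YW ∩ (W ∩ Γᶜ) := by
    ext ω; simp [hs1, hA, hW, hΓ, hYW]; tauto
  have e00 : {ω | Function.update (Function.update ω f₁ false) f₂ false ∈
      (((openEdge f₁ ∩ closedEdge f₂ ∩ YK) ∪ (closedEdge f₁ ∩ openEdge f₂ ∩ YW) ∪ (openEdge f₁ ∩ openEdge f₂ ∩ YB)) ∩ ((openEdge f₁ ∪ (openEdge f₂ ∩ W)) ∩ ((openEdge f₁ ∩ A) ∪ (openEdge f₂ ∩ Γ))ᶜ))} = ∅ := by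
    ext ω; simp [hs1, hA, hW, hΓ]
  rw [e11, e10, e01, e00, prob_empty]; ring

include hf hYK hYW hYB in
/-- The cell expansion of `P(U)`. -/
lemma rootw_prob_U :
    prob p ((openEdge f₁ ∩ closedEdge f₂ ∩ YK) ∪ (closedEdge f₁ ∩ openEdge f₂ ∩ YW) ∪ (openEdge f₁ ∩ openEdge f₂ ∩ YB))
      = p f₁ * p f₂ * prob p YB + p f₁ * (1 - p f₂) * prob p YK + (1 - p f₁) * p f₂ * prob p YW := by
  have hs1 := update2_fst hf
  rw [prob_two_pin p hf]
  have e11 : {ω | Function.update (Function.update ω f₁ true) f₂ true ∈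
      ((openEdge f₁ ∩ closedEdge f₂ ∩ YK) ∪ (closedEdge f₁ ∩ openEdge f₂ ∩ YW) ∪ (openEdge f₁ ∩ openEdge f₂ ∩ YB))} = YB := by
    ext ω; simp [hs1, hYB]
  have e10 : {ω | Function.update (Function.update ω f₁ true) f₂ false ∈
      ((openEdge f₁ ∩ closedEdge f₂ ∩ YK) ∪ (closedEdge f₁ ∩ openEdge f₂ ∩ YW) ∪ (openEdge f₁ ∩ openEdge f₂ ∩ YB))} = YK := by
    ext ω; simp [hs1, hYK]
  have e01 : {ω | Function.update (Function.update ω f₁ false) f₂ true ∈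
      ((openEdge f₁ ∩ closedEdge f₂ ∩ YK) ∪ (closedEdge f₁ ∩ openEdge f₂ ∩ YW) ∪ (openEdge f₁ ∩ openEdge f₂ ∩ YB))} = YW := by
    ext ω; simp [hs1, hYW]
  have e00 : {ω | Function.update (Function.update ω f₁ false) f₂ false ∈
      ((openEdge f₁ ∩ closedEdge f₂ ∩ YK) ∪ (closedEdge f₁ ∩ openEdge f₂ ∩ YW) ∪ (openEdge f₁ ∩ openEdge f₂ ∩ YB))} = ∅ := by
    ext ω; simp [hs1]
  rw [e11, e10, e01, e00, prob_empty]; ring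

include hf hA hW hΓ in
/-- The cell expansion of `P(B) = P(eᶜ ∩ Lᶜ ∩ γ)`. -/
lemma rootw_prob_B :
    prob p ((openEdge f₁ ∪ (openEdge f₂ ∩ W))ᶜ ∩ ((openEdge f₁ ∩ A) ∪ (openEdge f₂ ∩ Γ))ᶜ ∩ (A ∪ ((openEdge f₁ ∪ (openEdge f₂ ∩ W)) ∩ ((openEdge f₁ ∩ A) ∪ (openEdge f₂ ∩ Γ)))))
      = (1 - p f₁) * p f₂ * prob p (Wᶜ ∩ Γᶜ ∩ A) + (1 - p f₁) * (1 - p f₂) * prob p A := by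
  have hs1 := update2_fst hf
  rw [prob_two_pin p hf]
  have e11 : {ω | Function.update (Function.update ω f₁ true) f₂ true ∈
      ((openEdge f₁ ∪ (openEdge f₂ ∩ W))ᶜ ∩ ((openEdge f₁ ∩ A) ∪ (openEdge f₂ ∩ Γ))ᶜ ∩ (A ∪ ((openEdge f₁ ∪ (openEdge f₂ ∩ W)) ∩ ((openEdge f₁ ∩ A) ∪ (openEdge f₂ ∩ Γ)))))} = ∅ := by
    ext ω; simp [hs1, hA, hW, hΓ]
  have e10 : {ω | Function.update (Function.update ω f₁ true) f₂ false ∈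
      ((openEdge f₁ ∪ (openEdge f₂ ∩ W))ᶜ ∩ ((openEdge f₁ ∩ A) ∪ (openEdge f₂ ∩ Γ))ᶜ ∩ (A ∪ ((openEdge f₁ ∪ (openEdge f₂ ∩ W)) ∩ ((openEdge f₁ ∩ A) ∪ (openEdge f₂ ∩ Γ)))))} = ∅ := by
    ext ω; simp [hs1, hA, hW, hΓ]
  have e01 : {ω | Function.update (Function.update ω f₁ false) f₂ true ∈
      ((openEdge f₁ ∪ (openEdge f₂ ∩ W))ᶜ ∩ ((openEdge f₁ ∩ A) ∪ (openEdge f₂ ∩ Γ))ᶜ ∩ (A ∪ ((openEdge f₁ ∪ (openEdge f₂ ∩ W)) ∩ ((openEdge f₁ ∩ A) ∪ (openEdge f₂ ∩ Γ)))))} = Wᶜ ∩ Γᶜ ∩ A := by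
    ext ω; simp [hs1, hA, hW, hΓ]; tauto
  have e00 : {ω | Function.update (Function.update ω f₁ false) f₂ false ∈
      ((openEdge f₁ ∪ (openEdge f₂ ∩ W))ᶜ ∩ ((openEdge f₁ ∩ A) ∪ (openEdge f₂ ∩ Γ))ᶜ ∩ (A ∪ ((openEdge f₁ ∪ (openEdge f₂ ∩ W)) ∩ ((openEdge f₁ ∩ A) ∪ (openEdge f₂ ∩ Γ)))))} = A := by
    ext ω; simp [hs1, hA, hW, hΓ]
  rw [e11, e10, e01, e00, prob_empty]; ring

include hf hA hW hΓ in
/-- The cell expansion of `P(D) = P(eᶜ ∩ Lᶜ ∩ γᶜ)`. -/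
lemma rootw_prob_D :
    prob p ((openEdge f₁ ∪ (openEdge f₂ ∩ W))ᶜ ∩ ((openEdge f₁ ∩ A) ∪ (openEdge f₂ ∩ Γ))ᶜ ∩ (A ∪ ((openEdge f₁ ∪ (openEdge f₂ ∩ W)) ∩ ((openEdge f₁ ∩ A) ∪ (openEdge f₂ ∩ Γ))))ᶜ)
      = (1 - p f₁) * p f₂ * prob p (Wᶜ ∩ Γᶜ ∩ Aᶜ) + (1 - p f₁) * (1 - p f₂) * prob p Aᶜ := by
  have hs1 := update2_fst hf
  rw [prob_two_pin p hf]
  have e11 : {ω | Function.update (Function.update ω f₁ true) f₂ true ∈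
      ((openEdge f₁ ∪ (openEdge f₂ ∩ W))ᶜ ∩ ((openEdge f₁ ∩ A) ∪ (openEdge f₂ ∩ Γ))ᶜ ∩ (A ∪ ((openEdge f₁ ∪ (openEdge f₂ ∩ W)) ∩ ((openEdge f₁ ∩ A) ∪ (openEdge f₂ ∩ Γ))))ᶜ)} = ∅ := by
    ext ω; simp [hs1, hA, hW, hΓ]
  have e10 : {ω | Function.update (Function.update ω f₁ true) f₂ false ∈
      ((openEdge f₁ ∪ (openEdge f₂ ∩ W))ᶜ ∩ ((openEdge f₁ ∩ A) ∪ (openEdge f₂ ∩ Γ))ᶜ ∩ (A ∪ ((openEdge f₁ ∪ (openEdge f₂ ∩ W)) ∩ ((openEdge f₁ ∩ A) ∪ (openEdge f₂ ∩ Γ))))ᶜ)} = ∅ := by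
    ext ω; simp [hs1, hA, hW, hΓ]
  have e01 : {ω | Function.update (Function.update ω f₁ false) f₂ true ∈
      ((openEdge f₁ ∪ (openEdge f₂ ∩ W))ᶜ ∩ ((openEdge f₁ ∩ A) ∪ (openEdge f₂ ∩ Γ))ᶜ ∩ (A ∪ ((openEdge f₁ ∪ (openEdge f₂ ∩ W)) ∩ ((openEdge f₁ ∩ A) ∪ (openEdge f₂ ∩ Γ))))ᶜ)} = Wᶜ ∩ Γᶜ ∩ Aᶜ := by
    ext ω; simp [hs1, hA, hW, hΓ]; tauto
  have e00 : {ω | Function.update (Function.update ω f₁ false) f₂ false ∈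
      ((openEdge f₁ ∪ (openEdge f₂ ∩ W))ᶜ ∩ ((openEdge f₁ ∩ A) ∪ (openEdge f₂ ∩ Γ))ᶜ ∩ (A ∪ ((openEdge f₁ ∪ (openEdge f₂ ∩ W)) ∩ ((openEdge f₁ ∩ A) ∪ (openEdge f₂ ∩ Γ))))ᶜ)} = Aᶜ := by
    ext ω; simp [hs1, hA, hW, hΓ]
  rw [e11, e10, e01, e00, prob_empty]; ring

end Cells

end Summit.Ventures.PercRepro2
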